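import Literature.MathematicalPhysics.QuantumFieldTheory.Balaban1983to89.B11Thm1Exact
import Literature.MathematicalPhysics.QuantumFieldTheory.Balaban1983to89.B11Prop8Assembly
import Literature.MathematicalPhysics.QuantumFieldTheory.Balaban1983to89.B11B3

/-!
# `Balaban1983to89.B11Carve15SectFHyp` — [Balaban1985Variational] Sect. F «Regularity properties of minimal configurations»,
# pp. 300–305 (displays (144)–(169), Proposition 8 p. 304, the conclusion (169) ⇒ (9)–(10)) CARVED IN HYPOTHESIS FORM — the
# residual UNNUMBERED printed statements of these six pages that had no declaration, and ONE bundle `B11Carve15SectFHyp.Hyp`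
# conjoining the section's printed statements BY NAME (P6 carving fan, block 15; key item stmt-QuantumFields-20541
# `Record13SepCoPHInhabited` — row P11 «bg = [15] Thm 1 (8)–(10)» —, also feeds 19200, 20520)

statement-level skeleton of published theorems with citation tags; proofs where landed; nothing here is a claim about the Yang–Mills mass gap

CITATION HEADER (lean-in-tree rule 2026-08-18).  T. Bałaban, *The variational problem and background fields in renormalization group
method for lattice gauge theories*, Commun. Math. Phys. **102** (1985) 277–309, doi:10.1007/bf01229381 [Balaban1985Variational] (cell
paper B11 = [15] of [Balaban1987RG1]; its [3] = [Balaban1984PropagatorsII] (B6), [4] = [Balaban1985Averaging] (B7), [5] =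
[Balaban1985BackgroundPropagators] (B9), [6] = [Balaban1985RegularSpaces] (B8)).  PDF held: `paper:balaban1985-cmp102-variational-background`
(journal page = PDF page + 276); pp. 300–305 = PDF 24–29 re-read FIRST-HAND by this seat on the page renders
`pub/pub-balaban/b2b-balaban-ref1/pages/1985-cmp102-variational-background/1985-cmp102-variational-background-p024…p029-x2.png` (READ AS
IMAGES, 2026-08-28) and on the `lit read` text layer `p0024.txt`–`p0029.txt`; the locators «p. J [PDF P] pNNNN.txt:L<a>–<b>» below count
the lines of that text layer (formulas garbled there were read on the renders).  The paper is a MANUSCRIPT UNDER ADJUDICATION in this tree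
(audit cell `pub-balaban`): every `def … : Prop` below is a PRINTED statement typed as a proposition to be used as a HYPOTHESIS `(h : …)`;
every `theorem` is kernel-checked bookkeeping between typed forms, or real arithmetic of printed constants.  WHAT IS REPRODUCED = the 14
SKELETON rows of block 15 (`carve/BLOCKS-11-20.md` § Block 15: B11.Prop8, Eq144, Eq145, Eq147, Eq152, Eq154, Eq157, Eq159, Eq162, Eq163,
Eq165, Eq168, Claim@304, Eq169 — all IN TREE: cited below, not restated) plus the residual sentences listed under WHAT THIS FILE ADDS.
Unit `lit-balaban-carve-15-g0` (HOME `run/shared/lean/pub/lit-balaban/carve/`, rules `carve/CARVE-RULES.md`); three imports (`…B11Thm1Exact`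
and `…B11Prop8Assembly`, hence `…B11`; `…B11B3`, hence `…B6RandomWalk`); nothing in the tree is edited.

## IN TREE = CITED (the printed items of pp. 300–305 that already have declarations; NOT restated here)

* p. 300 [PDF 24] p0024.txt:L19–21, the programme of Sect. F «We will use only the fact that they are critical configurations of the
  functional (5) and that they belong to the spaces (6) with ε₀ sufficiently small»: this is the HYPOTHESIS SHAPE `Reg7 ε₁ V → InU ε₀ U →
  InB V U → IsCritical V U → ε₀ ≤ a₅ → …` of `B11.Prop8Printed` (B11.lean, Prop. 8), `B11.SectFPrinted` (B11.lean, Sect. F (169)),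
  `B11Thm1Exact.SectFPrintedExact`, `B11Prop8Assembly.HalvingStep`, `B11SectFAssembly.Leaves.reg165` over the Theorem-1 carrier
  `B11.VarProblemX` (fields `IsCritical`, `InU`, `InB`, `Reg7`; dictionary `B11.VarProblemX.Laws`).
* p. 300 (144), the cube tower «□₀ ⊃ □₁ ⋯ ⊃ □_j ⊃ □, dist(□_{n+1}, □_nᶜ) = R₁M₁Lⁿη», □̃ with «dist(□, □̃ᶜ) = 2R₁M₁Lʲη», «□̃ ⊂
  B^{j−1}(Λ_{j−1}) ∪ Bʲ(Λ_j) ⊂ Ω_{j−1}», «we assume that j = k»: row B11.Eq144 — `B11SectFCoverage.sectF_tilde_not_subset_prev`,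
  `sectF_tilde_reaches_frozen_layer`, `sectF_tilde_exits_Omega` (the flat-face witness ABOUT the printed clause «□̃ ⊂ Ω_{j−1}», cell GAPS
  G-B11-F6), `B11SectFReg165Assembly.ChainLeaves.sep144` (d(y₁, y₂) ≥ R₁M₁ across □_k), the cube class of [6] Sect. F p. 98
  `B8Eq131Cubes.box ∕ cube ∕ tcube ∕ margin_collar`; the carrier's `VarProblem.Cube ∕ scale ∕ sizeM` («a cube □ intersecting Ω_j but not
  Ω_{j+1}, of a size 2MLʲη», p0024.txt:L22).
* p. 301 [PDF 25] (145)–(146): row B11.Eq145 — `B11Smallness.ineq145` («4d(M + R₁M₁)L²ε₀ ≦ 8dL²Mε₀»), `B11Smallness.ineq146_iff`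
  (⟺ 11d² + 1 < dL²M) and the located variant `ineq146_corrected_iff` (GAPS C-B11-F1).
* p. 301 (147)–(151), V′, V′₁, ℭ_k (148), V″ (149), the local space (150), (151) «|V″ − 1| < 9dL²Mε₀ − ε₀ on ℭ_k», and p0025.txt:L21–24
  «The configuration U′_k is a minimum of the functional (5) in the space (6) with V′ instead of V, hence it is a minimum of this functional
  in the space (150), because this space is defined by more restrictive functional conditions and a sufficiently small neighborhood of
  U′_k in (150) is contained in (6)»: row B11.Eq147 — `B11LocalMin150.NearContained` (the sentence as a Prop, WITH BODY),
  `isLocalMinOn_transfer`, `isLocalMinOn_transfer_of_isMinOn`, `localMin150` (PROVED, cell C-B11-F5a); ℭ_k as finite multiscale sets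
  `B11SectFReg165Assembly.ChainData.calC ∕ nearC ∕ farC` with `ChainLeaves.calC_cover`; (151) inside `B11Eq155BlockLogWeighted.norm_ilog_wavg_lt_printed`.
* p. 301 (152)–(153), p0025.txt:L26–31 «Now we apply Theorem 2 of the paper [6] to the pair of configurations U′_k, 1 … We assume that
  9dL²Mε₀ ≦ c₁. Then there exists a unique gauge transformation u satisfying the restrictions ūʲ = 1 on Λ′_j, and such that U′_k^{u⁻¹} =
  U₁ = e^{iηA}, (152), R∂^{η*}A = 0 (153)»: row B11.Eq152 — [6] Theorem 2 itself `B8.Thm2Printed` (existence AND uniqueness), its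
  B11-edge `B11.p280_landau_gauge_of_B8Thm2`, the Sect.-F reading `B11SectFReg165Assembly.ChainLeaves.h152` («Gauged U □ ∧ ‖A‖ <
  9dL²B₁Mε₀» under «9dL²Mε₀ ≦ c₁»), the Hölder companion `B11Holder9.holder152_of_thm2`, `B11Holder9.smallness152_of_M_le`; the single
  gauge on the whole tower {□_n} `B11GaugeGlue` (module docstring, GAPS C-B11-G11b).
* p. 302 [PDF 26] (154)–(156), V₁ = e^{iB}, «|B| < 18d²L³Mε₀ (155) for c₁ sufficiently small», «Q(ηA) = B (156)»: row B11.Eq154 —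
  `B11Eq155BlockLog.blockAvg ∕ V1 ∕ fieldB ∕ ineq155 ∕ arith155` (PROVED with the smallness explicit), `B11Eq155BlockLogWeighted.*`,
  `B11SectFReg165Assembly.ChainLeaves.h155`, `B11Reparam190.ineq190_reparam_one` (the (154)-reparametrisation B ↔ B′).
* p. 302 (157)–(158), the functional 𝔉(A′), «A = A′ − HD(A′). The configuration A′ satisfies (152) with 36 instead of 9 on the right-hand
  side. We have to assume that 36dL²B₁Mε₀ ≦ a₃», «representing it as A₁ + HB, we obtain Eq. (143) for A₁ … (158)», «The configurations HB
  and A₁ satisfy (152) with the bounds 4dL²B₁Mε₀ and 40dL²B₁Mε₀ correspondingly … we assume that 40dL²B₁Mε₀ ≦ a₄», p0026.txt:L32–34 «all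
  the operators in this section are taken without any external gauge field configuration (or alternatively with the configuration equal
  to 1). These operators were considered in [2,3]»: row B11.Eq157 — `B11Prop6Scheme.mapT ∕ mapT_158 ∕ eq158_solution ∕ conditions_143 ∕
  eq143_solution` ((158) = (143) at the background 1), `B11SectFReg165Assembly.ChainData` (opH ∕ opD ∕ opGt ∕ opW «without any external
  gauge field») with `ChainLeaves.h157` (the change of variables and «36 instead of 9») and `ChainLeaves.h158`, the smallness binders
  «36dL²B₁Mε₀ ≦ a₃», «40dL²B₁Mε₀ ≦ a₄» of `B11SectFAssembly.Leaves.reg165 ∕ reg165_unit` and of `ChainLeaves.h157 ∕ h158`; the flat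
  background `B11Eq98V0LettersFlat.plaqU_flat ∕ flat_unitary_unitBounded`; the minimum ⇒ (158) step `B11LocalMin150.localMin150` +
  `B11SectFReg165Assembly.ChainLeaves.h158`.
* pp. 302–303, first case (p0026.txt:L35–41, p0027.txt:L2): «To prove that U_k belongs to the space (8) we have to prove the inequalities
  (2) with ε₀ = B₃ε₁. They are local … we take a unit cube Δ₀ ⊂ Bʲ(Λ_j) … The cube Δ₀ is contained in a big cube of the size 2R₁M₁Lʲη and
  we take □ as this big cube … These inequalities, and the gauge invariance of the left-hand sides of (2), imply that U_k belongs to the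
  space (8)»: `B11SectFAssembly.CubeData` + `Leaves.inU_local ∕ reg165_unit ∕ dev1142`, `B11SectFReg165Assembly.UnitData ∕ UnitLeaves ∕
  reg165_unit_of_chain`, `B11SectFCoverage` (Δ₀ = Bʲ(y) at the top layer).
* p. 303 [PDF 27] (159)–(161), «A = A₁ + HB − HD(A₁ + HB) (159)», «|V′₁(∂p) − 1| < ε₁ for p ∈ □″_k^{(k)}, and |V′₁(∂p) − 1| < 2L²ε₁ for
  p ⊂ □′_k^{(k)}», Lemma 1 of [6], (160) «|B(x,x′)| < (8d²L² + 4L²|x − y|)ε₁», the chain (161): row B11.Eq159 — `B11Eq160BondField.ineq160 ∕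
  ineq160_caseI ∕ ineq160_caseII_of_lemma1` (PROVED from [6] Lemma 1 `B8.Lemma1Printed`), `B11SectFReg165Assembly.ChainLeaves.h160 ∕ h161 ∕
  h157`; (161) `B11Eq161HBChain.kernelSum ∕ line2 ∕ line3 ∕ line4 ∕ ineq161 ∕ line4_le_quarter` (PROVED chain), `B11Eq161HBChainLevelRadii.*`.
* p. 303 (162) and p0027.txt:L30 «It follows from the inequalities (2.47)–(2.51) of [3] that B₃ depends on d and L only»: row B11.Eq162 —
  `B11B3.term162 ∕ sum162` (the summand and inner sum of (162), WITH BODY), `B11B3.Claim162` (the sentence as a Prop), PROVED from [3]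
  Lemma 2.1 as `B11B3.claim162_of_lemma21` (located smallness ¼δ₀R₁M₁ ≥ log L, `B11B3.divergence_witness`), `B11B3Repaired.claim162_of_lemma21Repaired ∕
  B3Upper ∕ B3_le_B3Upper`, `B11.B3_lower_bounds`, `B11SectFReg165Assembly.ChainLeaves.sum162_le ∕ B₃_eq`.
* p. 304 [PDF 28] (163)–(164), p0028.txt:L2 «We may assume that R₁M₁ is sufficiently big, so that B₃e^{−(1/2)δ₀R₁M₁} ≦ ½ (163)»: row
  B11.Eq163 — `B11B3.ineq161_le_quarter_B3` (72 = 4·18), `B11Eq161HBChain.ineq164 ∕ ineq164_strict`, `B11SectFReg165Assembly.ChainLeaves.ineq163 ∕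
  ineq163_at_size ∕ ineq164_box ∕ ineq164_unit`.
* p. 304 (165)–(167), a₅ (166) «We take a largest absolute number a₅ such that M′ε₀ ≦ a₅ implies all the previous restrictions on ε₀, and
  such that B₀(C₄ + 4C₂)(36dL²B₁R₁M₁)²a₅ ≦ ⅛ (166)», «M′ = 1 in the first case … M′ = (R₁M₁)⁻¹M in the second case»: row B11.Eq165 —
  `B11Smallness.ineq165_quadratic_terms` (M = M′R₁M₁), `ineq167_of_166` (printed ⅛), `ineq167_first_case`, `B11Eq161HBChain.ineq165 ∕ ineq167 ∕
  lt_eps'_of_167 ∕ ineq167_sixteenth`, `B11SectFReg165Assembly.K165 ∕ ineq165_box ∕ ineq165_unit ∕ reg165_of_chain`, `B11SectFAssembly.a5 ∕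
  a5_pos ∕ firstCase_arith` (a₅ explicit with the REPAIRED (166′) K·a₅ ≤ 1/16, cell GAPS G-B11-02: with the printed ⅛ the clause «similarly
  for |∂U₁ − 1|» of (168) misses the radius by the second-order term of [6] (1.141) — `B11Eq161HBChain.plaq168_asPrinted_exceeds ∕
  plaq168_repaired`).
* p. 304 (168) «|D^{η*}_{U₁}∂U₁| < ε′ + 86dε′² < 2ε′ on Δ₀ (168) for ε′ small, similarly for |∂U₁ − 1|» with [6] (1.54)/(1.141)–(1.142): row
  B11.Eq168 — `B11Smallness.ineq168_iff` (⟺ 86dε′ < 1), `two_eps'_eq`, `B11Eq161HBChain.ineq168 ∕ ineq168_radius ∕ e1_eq_eps'`,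
  `B11SectFAssembly.Leaves.dev1142`, `B8Ineq1141SectG` ([6] (1.141)–(1.142)).
* p. 304 p0028.txt:L21–27, «hence U_k belongs to the space (2) with max{B₃ε₁, ½ε₀} instead of ε₀. If ½ε₀ ≦ B₃ε₁, then the required
  regularity is proved. If ½ε₀ > B₃ε₁, then we apply again the whole reasoning with ½ε₀ instead of ε₀. We continue this way until we
  reach the bound B₃ε₁»: `B11Prop8Assembly.HalvingStep` (the one-step conclusion as a Prop — USED below), `inU_iterate`, `max_half_le`,
  `stage_le`, `B11.halving_reaches_B3eps1`, `B11SectFAssembly.halvingStep_of_leaves` (the step DERIVED from the located leaves).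
* p. 304 PROPOSITION 8 (p0028.txt:L29–31): row B11.Prop8 — `B11.Prop8Printed B₃ fam` (decl of record — USED below),
  `B11Prop8Assembly.prop8Printed_of_halvingStep`, `B11SectFAssembly.prop8Printed_of_leaves`; at the T³ carrier (desk stem, cited only)
  `T3Thm1CarrierNative.Prop8NativeAt ∕ prop8Printed_famX_iff_native`.
* p. 304 p0028.txt:L32–36 «We have constructed the minimal configuration U_k in the space (2) with ε₀ = O(1)B₃ε₁, hence we have the
  additional restriction on ε₁: O(1)B₃ε₁ ≦ a₅. Now we define a₁ as a largest constant such, that the restriction ε₁ ≦ a₁ implies all the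
  other restrictions we have imposed on ε₁. Especially it implies that U_k is in the space (8)»: row B11.Claim@304 —
  `B11.thm1_of_prop7_prop8_sectF` (a₁ := min{a′₁, a₁(F), a₅/(O(1)C₁B₃), a₀/B₃}), `B11Thm1Exact.thm1Exact_of_prop7_prop8_sectF`,
  `B11Prop8Assembly.thm1Printed_of_step`, `B11SectFAssembly.a1F ∕ a1F_pos ∕ thm1Printed_of_prop7_leaves`, `B11Thm1.thm1At_allLevels` (desk stem,
  cited only).
* pp. 304–305, second case, (169) p0029.txt:L2–4 «Assuming M′B₃ε₁ ≦ a₅, we get from the inequality (167), (the left-hand side of (167)) <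
  ¼MB₃ε₁ + ⅛M′B₃ε₁ < ½MB₃ε₁. (169) The condition M′ε₁ ≦ a₁ implies M′B₃ε₁ ≦ a₅, hence we have proved the regularity conditions (9),
  (10), and the proof of Theorem 1 is completed»: row B11.Eq169 — `B11.ineq169`, `B11Eq161HBChain.ineq169_regularity`,
  `B11SectFAssembly.threshold_of_M_le ∕ regularity_of_leaves ∕ sectFPrinted_of_leaves`, `B11Holder9.holder9_of_thm2_136 ∕ B4 ∕ holder9_located`
  (the Hölder clause of (9), cell GAPS G-B11-F3: not derived in print), the statements of record `B11.SectFPrinted B₃ fam` (∃ RM) and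
  `B11Thm1Exact.SectFPrintedExact B₃ R₁M₁ fam` (the printed ceiling M ≦ R₁M₁(a₁/ε₁) — USED below), `B11.Regularity` ((9)–(10)).

## WHAT THIS FILE ADDS (residual printed sentences with no declaration; hypothesis form; and the bundle)

* `CubeSizeMultiplePrinted` — p. 300 p0024.txt:L22–26: «We are interested in two cases. To prove that U_k is in the space (8) we will
  take M = R₁M₁. To prove the regularity properties (9), (10) we will admit more general M, depending on ε₁. In both cases M ≧ R₁M₁ and we
  assume that M is a multiple of R₁M₁, i.e. M = M′R₁M₁, M′ is an integer.» — the INTEGRALITY of M′ (in tree only the inequality M ≧ R₁M₁,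
  `B11SectFAssembly.Leaves.size_ge` ∕ `ChainLeaves.size_ge`, and the real quotient M′ = M/(R₁M₁) of `B11Smallness.ineq165_quadratic_terms`,
  `B11.ineq169`), typed over the Theorem-1 carrier; kernel: `size_ge_of_multiple` (⇒ the `size_ge` shape), `quotient_of_multiple`
  (M′ = M/(R₁M₁) is that integer, ≥ 1).
* `TildeSmallFieldPrinted` — p. 300 p0024.txt:L35–37: «The configuration U_k belongs to the space (2) with ε₀ sufficiently small, hence
  U′_k satisfies the conditions (2) on □̃ with L²ε₀η² on the right-hand side.» — the ONE-LEVEL LOSS L² on □̃ ⊂ Ω_{k−1} (the plaquette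
  bound of (2) p. 278 read at j = k − 1: ε₀L^{−2(k−1)} = L²ε₀η²), the input of (145); typed with ONE explicit letter `smallTilde` for
  «satisfies the plaquette condition of (2) on □̃(□) with r·η²(Lʲη)⁻² on the right-hand side, j the scale of □ — = r·η² at j = k, the
  printed case» (the carrier names only the global spaces 𝔘_k);
  discussed but not declared in `B11SectFCoverage` (module docstring «LOCATED EDGE»).  Not a bundle conjunct (its content is upstream of the
  bundle's slots (152) → (165) → Prop. 8 ∕ (169)).
* `Restriction158Eps1Printed` — p. 302 p0026.txt:L26–31: «we assume that 40dL²B₁Mε₀ ≦ a₄. We can write it as an assumption on ε₁ using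
  Proposition 7, more exactly the equality ε₀ = O(1)C₁B₃ε₁. Let us notice that for the purpose of the proof of the regularity properties
  we can take C₁ = L³, as it follows from the constructions at the beginning of the Sect. A. Thus our assumption is of the form O(1)B₃Mε₁
  ≦ a₄.» — the printed SHAPE «O(1)B₃Mε₁ ≦ a₄» with O(1) a parameter; kernel: `restriction158_iff_eps1Form` (the ε₀-form IS the ε₁-form with
  O(1) = 40dL⁵B₁·O(1)_{Prop 7}), `bound152prime_eq_eps1Form` (p. 303 p0027.txt:L6–7 «36dL²B₁Mε₀ = O(1)B₃Mε₁»).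
* `Hyp` (full name `…B11Carve15SectFHyp.Hyp`) — THE BUNDLE keyed to the consumer: `(∀ i, CubeSizeMultiplePrinted (fam i) R₁M₁) ∧
  B11B3.Claim162 δ₀ geo adm ∧ (∃ a₅ > 0, ∀ i, B11Prop8Assembly.HalvingStep (fam i) B₃ a₅) ∧ B11.Prop8Printed B₃ fam ∧
  B11Thm1Exact.SectFPrintedExact B₃ R₁M₁ fam` — the cube-size convention of p. 300, «B₃ depends on d and L only» (162), the one-step
  conclusion p. 304, Proposition 8, and the Sect. F conclusion (169) ⇒ (9)–(10) with the printed ceiling M ≦ R₁M₁(a₁/ε₁), with ONE B₃ and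
  ONE R₁M₁ shared by all slots; accessors and the derived forms a node prover wants: `Hyp.sectF` (`B11.SectFPrinted`), `Hyp.prop8_of_halving`
  (coherence of the two Prop-8 slots under `Laws` (i)), `Hyp.thm1Exact` ∕ `Hyp.thm1` (THEOREM 1 as printed, given Proposition 7 and the
  dictionary `Laws` — by `B11Thm1Exact.thm1Exact_of_prop7_prop8_sectF` ∕ `B11.thm1_of_prop7_prop8_sectF`), `Hyp.regularity`.
* §4 non-vacuity: a one-point model `toyP` of the carrier on which `Hyp` HOLDS (`hyp_toyP`, nonempty index) and a model on which it FAILS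
  (`not_hyp_toyP_half`: sizeM ≡ R₁M₁/2 violates the cube-size conjunct) — the bundle is neither void nor trivially true.

## HONEST SCOPE / NOT TYPED

(i) p. 301 p0025.txt:L6–8 «the gauge transformation changing U_k into U′_k does not belong to the subgroup (4) leaving the space (3)
invariant. In fact the configuration V defining this space is changed into a configuration V′» is explanatory prose (its content is the
datum V′ ∕ V′₁ ∕ V″ of (147)–(150), row B11.Eq147); not typed separately.  (ii) p. 302 p0026.txt:L16–19 «we get an open set of
configurations A′ … Repeating the arguments of Sect. E we extend the domain of A′ to configurations satisfying (123) instead of (157)» is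
a by-analogy step whose OUTPUT (158) is typed (`ChainLeaves.h158`, `B11Prop6Scheme.eq158_solution`); the step itself is lattice-level
(Sect. E (123)–(126): `B11CriticalSlice.fderiv_comp_param_eq_zero`) and is not re-typed here.  (iii) (145)–(146), (155), (160)–(161),
(163)–(169) are in tree as real-arithmetic ∕ abstract-operator theorems (rows above); their lattice-level premises (the averages Ū′_k,
[4] Prop. 2, [6] (1.65), Lemma 1 of [6]) are the hypothesis fields of `ChainLeaves` ∕ `UnitLeaves` ∕ `Leaves` — inherited, not
re-adjudicated; likewise the located readings G-B11-02 ((166) ⅛ vs 1/16), C-B11-F1 ((146)), G-B11-F3 (Hölder clause of (9)), G-B11-F6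
(«□̃ ⊂ Ω_{j−1}»), G-pv21-1 (¼δ₀R₁M₁ ≥ log L behind «B₃ depends on d and L only»).  (iv) «absolute constant» a₅ = (d, L)-dependent
(DIVERGENCE D-B11-3), typed as chosen BEFORE the member `i` of the family.  (v) `TildeSmallFieldPrinted` types the PLAQUETTE clause of
(2) on □̃ (the one (145) consumes through [4] Prop. 2); print's «the conditions (2)» also names the bond clause |D*_U∂U| (whose level-(k−1)
right-hand side would read L³ε₀η² by (2)) — not typed.  (vi) Sect. G from (170) on (p. 305 ff.) is block 16, not this file.  (vii) No
instance, no notation, no `sorry`; axioms standard.  Nothing here proves a summit statement or bears on the Clay problem; the node count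
does not move.

VERSIONS.  v1 = p612458 (ACCEPTED 2026-08-28T07:30Z, commit 7b0a2d4f8402; refereed `carve/CHECK-5.md` § 07:36:34Z: PASS-WITH-NOTES, 0 MISSTATED).
v1.1 (this text) = DOCSTRING-ONLY touch over v1, every declaration (signature and body) byte-identical: (i) `CubeSizeMultiplePrinted` — the
p. 279 locator of the cube class added (referee note N-c5-12); (ii) `TildeSmallFieldPrinted` and the § WHAT THIS FILE ADDS line — the letter
`smallTilde r U □` is read at the scale j of □ («r·η²(Lʲη)⁻² on the right-hand side», = r·η² at j = k, the printed case), making the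
«obvious rescalings» of p. 300 explicit for class cubes of scale j < k; (iii) this VERSIONS paragraph.  Referee notes N-c5-13 (slot (2)'s
`∃ S` ∕ index `J` not tied to `B₃` ∕ `I` — the identification B₃ = 72d³L³B₀·S is `B11SectFReg165Assembly.ChainLeaves.B₃_eq`, cited) and
N-c5-14 (the two shape-only residuals stay outside the bundle) record design facts already stated in this header; nothing to change.
-/

namespace Literature.MathematicalPhysics.QuantumFieldTheory.Balaban1983to89.B11Carve15SectFHyp

open B11

variable {I : Type}

/-! ## §1 p. 300 — the cube-size convention of Sect. F («M = M′R₁M₁, M′ is an integer») -/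

/-- **The cube-size convention of Sect. F** (p. 300 [PDF 24] p0024.txt:L22–26, verbatim): *"Let us take a cube □ intersecting Ω_j but
not Ω_{j+1}, of a size 2MLʲη. We are interested in two cases. To prove that U_k is in the space (8) we will take M = R₁M₁. To prove the
regularity properties (9), (10) we will admit more general M, depending on ε₁. In both cases M ≧ R₁M₁ and we assume that M is a
multiple of R₁M₁, i.e. M = M′R₁M₁, M′ is an integer."*  Typed over the Theorem-1 carrier `B11.VarProblemX` (`sizeM □` = the size
parameter M of the class cube □, B11.lean): every class cube has M = M′·R₁M₁ with M′ a POSITIVE INTEGER (M′ = 1 being the first case,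
M′ ≥ 1 the second); `R₁M₁` = the fixed number R₁M₁ of (1) p. 277 / (144).  The carrier-level ∀-over-`P.Cube` reading is print's
own definition of the cube CLASS of Theorem 1, p. 279 [PDF 3] p0003.txt:L3–6, verbatim: *"More exactly we assume that □ has a size
2MLʲη, where M is a multiple of R₁M₁, … We consider all cubes □ satisfying the above conditions."* (so the conjunct restricts no
faithful instance of the carrier; referee note N-c5-12, `carve/CHECK-5.md`).  In tree only the consequences «M ≧ R₁M₁»
(`B11SectFAssembly.Leaves.size_ge`, `B11SectFReg165Assembly.ChainLeaves.size_ge`) and the real quotient M′ = (R₁M₁)⁻¹M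
(`B11Smallness.ineq165_quadratic_terms`, `B11.ineq169`) were declared. [cite: Balaban1985Variational, Sect. F p.300 ll.22–26 (before (144)) + p.279 ll.3–6 (the cube class)] -/
def CubeSizeMultiplePrinted (P : VarProblemX) (R₁M₁ : ℝ) : Prop :=
  ∀ c : P.Cube, ∃ M' : ℕ, 1 ≤ M' ∧ P.sizeM c = (M' : ℝ) * R₁M₁

/-- Kernel bookkeeping: the convention implies the in-tree shape «M ≧ R₁M₁» (`Leaves.size_ge` / `ChainLeaves.size_ge`) for R₁M₁ ≥ 0.
[cite: Balaban1985Variational, Sect. F p.300 «In both cases M ≧ R₁M₁» (bookkeeping)] -/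
theorem size_ge_of_multiple {P : VarProblemX} {R₁M₁ : ℝ} (h : CubeSizeMultiplePrinted P R₁M₁) (hR : 0 ≤ R₁M₁)
    (c : P.Cube) : R₁M₁ ≤ P.sizeM c := by
  obtain ⟨M', hM', hsize⟩ := h c
  have h1 : (1 : ℝ) ≤ (M' : ℝ) := by exact_mod_cast hM'
  rw [hsize]
  nlinarith

/-- Kernel bookkeeping: the «M′ = (R₁M₁)⁻¹M» of p. 304 (after (165)) IS the integer M′ of p. 300, and it is ≥ 1 (R₁M₁ > 0).
[cite: Balaban1985Variational, Sect. F p.300 + p.304 «M′ = (R₁M₁)⁻¹M in the second case» (bookkeeping)] -/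
theorem quotient_of_multiple {P : VarProblemX} {R₁M₁ : ℝ} (h : CubeSizeMultiplePrinted P R₁M₁) (hR : 0 < R₁M₁)
    (c : P.Cube) : ∃ M' : ℕ, 1 ≤ M' ∧ P.sizeM c / R₁M₁ = (M' : ℝ) ∧ 1 ≤ P.sizeM c / R₁M₁ := by
  obtain ⟨M', hM', hsize⟩ := h c
  have h1 : (1 : ℝ) ≤ (M' : ℝ) := by exact_mod_cast hM'
  have hq : P.sizeM c / R₁M₁ = (M' : ℝ) := by
    rw [hsize, mul_div_assoc, div_self hR.ne', mul_one]
  exact ⟨M', hM', hq, hq ▸ h1⟩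

/-! ## §2 p. 300 — the one-level loss on the cube □̃ («(2) on □̃ with L²ε₀η² on the right-hand side») -/

/-- **The small-field condition inherited on □̃** (p. 300 [PDF 24] p0024.txt:L33–37, verbatim): *"Now we repeat all the constructions of
the Sect. F in [6]. Applying a gauge transformation to U_k we get a configuration U′_k such, that U′_k ∈ Ax_k(□̃^{(k)}, 1), and Ū′ᵏ_k
satisfies the generalized axial gauge conditions on □̃^{(k)}. The configuration U_k belongs to the space (2) with ε₀ sufficiently small,
hence U′_k satisfies the conditions (2) on □̃ with L²ε₀η² on the right-hand side."*  (By (144) □̃ ⊂ B^{j−1}(Λ_{j−1}) ∪ Bʲ(Λ_j) ⊂ Ω_{j−1},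
and (2) p. 278 reads on Ω_{j−1}, at j = k: |U(∂p) − 1| < ε₀L^{−2(k−1)} = L²ε₀η²; (2) is gauge invariant, p. 304.)  Typed over the
Theorem-1 carrier with ONE explicit letter `smallTilde r U □` := «the configuration U (equivalently its generalized-axial-gauge transform
U′ on □̃^{(j)}) satisfies the PLAQUETTE condition of (2) on the cube □̃ of (144) built on □, with r·η²(Lʲη)⁻² on the right-hand side,
j = `scale □` — i.e. r·η² at j = k, the printed case (p. 300 «we assume that j = k, a general case can be obtained by obvious
rescalings»: for a class cube of scale j, □̃ ⊂ Ω_{j−1} and (2) there reads ε₀η²(L^{j−1}η)⁻² = L²ε₀·η²(Lʲη)⁻²)» — the carrier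
`B11.VarProblemX` names only the global spaces 𝔘_k({Ω_j}, ε₀) (`InU`).  The statement: membership in (2) with ε₀ gives the □̃-local
condition with r = L²ε₀, for every class cube □.
The input of (145) (row B11.Eq145, `B11Smallness.ineq145`, whose binder `0 ≤ L²ε₀` is this r).  A hypothesis slot, never asserted.
[cite: Balaban1985Variational, Sect. F p.300 ll.33–37 (before (145))] -/
def TildeSmallFieldPrinted (P : VarProblemX) (smallTilde : ℝ → P.Cfg → P.Cube → Prop) : Prop :=
  ∀ (ε₀ : ℝ) (U : P.Cfg) (c : P.Cube), P.InU ε₀ U → smallTilde (P.L ^ 2 * ε₀) U c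

/-- Kernel bookkeeping: with the monotonicity of the letter in its radius (the plaquette condition of (2) is a strict upper bound, cf.
`B11.VarProblemX.Laws` (i)) the inherited radius L²ε₀ may be replaced by any r ≥ L²ε₀ — the form in which (145) continues
(«≦ 4d(M + R₁M₁)L²ε₀ ≦ 8dL²Mε₀»). [cite: Balaban1985Variational, Sect. F p.300–301, (145) (bookkeeping)] -/
theorem tildeSmallField_mono {P : VarProblemX} {smallTilde : ℝ → P.Cfg → P.Cube → Prop}
    (h : TildeSmallFieldPrinted P smallTilde)
    (mono : ∀ (r r' : ℝ) (U : P.Cfg) (c : P.Cube), r ≤ r' → smallTilde r U c → smallTilde r' U c)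
    {ε₀ r : ℝ} {U : P.Cfg} (hU : P.InU ε₀ U) (hr : P.L ^ 2 * ε₀ ≤ r) (c : P.Cube) : smallTilde r U c :=
  mono _ _ U c hr (h ε₀ U c hU)

/-! ## §3 p. 302 — the restriction «40dL²B₁Mε₀ ≦ a₄» in its ε₁-form «O(1)B₃Mε₁ ≦ a₄» -/

/-- **The restriction behind (158) in its ε₁-form** (p. 302 [PDF 26] p0026.txt:L24–31, verbatim): *"The configurations HB and A₁ satisfy
(152) with the bounds 4dL²B₁Mε₀ and 40dL²B₁Mε₀ correspondingly. The image of U′_k translated by −HB satisfies Eq. (158). We assume that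
it belongs to the domain on which this equation has a unique solution, i.e. we assume that 40dL²B₁Mε₀ ≦ a₄. We can write it as an
assumption on ε₁ using Proposition 7, more exactly the equality ε₀ = O(1)C₁B₃ε₁. Let us notice that for the purpose of the proof of the
regularity properties we can take C₁ = L³, as it follows from the constructions at the beginning of the Sect. A. Thus our assumption is
of the form O(1)B₃Mε₁ ≦ a₄."*  The printed SHAPE of the last sentence, with its O(1) an explicit parameter `O₁` (a₄ = the constant of
Proposition 6, `B11.Prop6Printed`; B₃ of (162); M the size parameter of □).  The content is the kernel dictionary below
(`restriction158_iff_eps1Form`); the ε₀-form itself is the binder «40dL²B₁Mε₀ ≦ a₄» of `B11SectFAssembly.Leaves.reg165` ∕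
`B11SectFReg165Assembly.ChainLeaves.h158`. [cite: Balaban1985Variational, Sect. F p.302 ll.24–31 (after (158))] -/
def Restriction158Eps1Printed (O₁ B₃ M ε₁ a₄ : ℝ) : Prop :=
  O₁ * B₃ * M * ε₁ ≤ a₄

/-- Kernel dictionary: under the printed substitutions ε₀ = O(1)C₁B₃ε₁ (Proposition 7, `B11.Prop7Printed`'s O₁) and C₁ = L³ (Sect. A),
the ε₀-form «40dL²B₁Mε₀ ≦ a₄» IS the ε₁-form «O(1)B₃Mε₁ ≦ a₄» with O(1) = 40dL⁵B₁·O(1)_{Prop 7}.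
[cite: Balaban1985Variational, Sect. F p.302 ll.26–31 (arithmetic)] -/
theorem restriction158_iff_eps1Form {d L B₁ B₃ C₁ O₁ M ε₀ ε₁ a₄ : ℝ} (hε₀ : ε₀ = O₁ * C₁ * B₃ * ε₁) (hC₁ : C₁ = L ^ 3) :
    40 * d * L ^ 2 * B₁ * M * ε₀ ≤ a₄ ↔ Restriction158Eps1Printed (40 * d * L ^ 5 * B₁ * O₁) B₃ M ε₁ a₄ := by
  unfold Restriction158Eps1Printed
  have e : 40 * d * L ^ 2 * B₁ * M * ε₀ = 40 * d * L ^ 5 * B₁ * O₁ * B₃ * M * ε₁ := by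
    rw [hε₀, hC₁]; ring
  rw [e]

/-- Kernel dictionary for p. 303 [PDF 27] p0027.txt:L6–7, verbatim: *"We know also that A₁ + HB satisfies the bounds (152) with
36dL²B₁Mε₀ = O(1)B₃Mε₁ on the right-hand side."* — under the same substitutions 36dL²B₁Mε₀ = (36dL⁵B₁·O(1)_{Prop 7})·B₃Mε₁.
[cite: Balaban1985Variational, Sect. F p.303 ll.6–7 (arithmetic)] -/
theorem bound152prime_eq_eps1Form {d L B₁ B₃ C₁ O₁ M ε₀ ε₁ : ℝ} (hε₀ : ε₀ = O₁ * C₁ * B₃ * ε₁) (hC₁ : C₁ = L ^ 3) :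
    36 * d * L ^ 2 * B₁ * M * ε₀ = (36 * d * L ^ 5 * B₁ * O₁) * B₃ * M * ε₁ := by
  rw [hε₀, hC₁]; ring

/-- Kernel bookkeeping for the same passage: the three displayed restrictions of Sect. F on a cube of size M — «9dL²Mε₀ ≦ c₁» (p. 301,
before (152)), «36dL²B₁Mε₀ ≦ a₃» (p. 302), «40dL²B₁Mε₀ ≦ a₄» (p. 302) — all follow from ONE restriction of the printed kind «M′ε₀ ≦ a»
(p. 304 «We take a largest absolute number a₅ such that M′ε₀ ≦ a₅ implies all the previous restrictions on ε₀»), M = M′R₁M₁, with the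
explicit admissible a := min{c₁/(9dL²R₁M₁), a₃/(36dL²B₁R₁M₁), a₄/(40dL²B₁R₁M₁)} (d, L, B₁, R₁M₁ > 0; any real M′).
[cite: Balaban1985Variational, Sect. F p.304 ll.10–11 «M′ε₀ ≦ a₅ implies all the previous restrictions on ε₀» (arithmetic)] -/
theorem previous_restrictions_of_Mprime {d L B₁ R₁M₁ c₁ a₃ a₄ M' ε₀ : ℝ} (hd : 0 < d) (hL : 0 < L) (hB₁ : 0 < B₁)
    (hR : 0 < R₁M₁)
    (h : M' * ε₀ ≤ min (c₁ / (9 * d * L ^ 2 * R₁M₁))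
      (min (a₃ / (36 * d * L ^ 2 * B₁ * R₁M₁)) (a₄ / (40 * d * L ^ 2 * B₁ * R₁M₁)))) :
    9 * d * L ^ 2 * (M' * R₁M₁) * ε₀ ≤ c₁ ∧ 36 * d * L ^ 2 * B₁ * (M' * R₁M₁) * ε₀ ≤ a₃ ∧
      40 * d * L ^ 2 * B₁ * (M' * R₁M₁) * ε₀ ≤ a₄ := by
  have h9 : 0 < 9 * d * L ^ 2 * R₁M₁ := by positivity
  have h36 : 0 < 36 * d * L ^ 2 * B₁ * R₁M₁ := by positivity
  have h40 : 0 < 40 * d * L ^ 2 * B₁ * R₁M₁ := by positivity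
  have h1 : M' * ε₀ ≤ c₁ / (9 * d * L ^ 2 * R₁M₁) := le_trans h (min_le_left _ _)
  have h2 : M' * ε₀ ≤ a₃ / (36 * d * L ^ 2 * B₁ * R₁M₁) := le_trans h (le_trans (min_le_right _ _) (min_le_left _ _))
  have h3 : M' * ε₀ ≤ a₄ / (40 * d * L ^ 2 * B₁ * R₁M₁) := le_trans h (le_trans (min_le_right _ _) (min_le_right _ _))
  rw [le_div_iff₀ h9] at h1
  rw [le_div_iff₀ h36] at h2
  rw [le_div_iff₀ h40] at h3
  refine ⟨?_, ?_, ?_⟩ <;> nlinarith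

/-! ## §4 The bundle of block 15 (pp. 300–305) keyed to the consumer -/

/-- **BLOCK 15 OF [Balaban1985Variational] IN HYPOTHESIS FORM** — the printed statements of Sect. F (pp. 300–305) conjoined BY NAME over the
carriers of record, for a family `fam : I → B11.VarProblemX` of variational problems (fixed d, L; one member per geometric datum
(k; {Ω_j}; 𝔅_k), cf. `B11.Thm1Printed`) and a family `geo : J → B6.Geometry` of the multiscale situations (k; ℭ_k) of (148)/(162) with
their admissible observation points `adm` ((161): y₁ ∈ Δ ⊂ □):
(1) the cube-size convention p. 300 (`CubeSizeMultiplePrinted`, M = M′R₁M₁, M′ ∈ ℕ, M′ ≥ 1);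
(2) **(162)** «B₃ = 72d³L³B₀ sup sup Σ … It follows from the inequalities (2.47)–(2.51) of [3] that B₃ depends on d and L only» as
    `B11B3.Claim162 δ₀ geo adm` (p. 303);
(3) the one-step conclusion of Sect. F p. 304 «hence U_k belongs to the space (2) with max{B₃ε₁, ½ε₀} instead of ε₀», with ONE absolute
    a₅ ((166)) chosen BEFORE the member: `∃ a₅ > 0, ∀ i, B11Prop8Assembly.HalvingStep (fam i) B₃ a₅`;
(4) **PROPOSITION 8** p. 304 `B11.Prop8Printed B₃ fam`;
(5) the conclusion of Sect. F, **(169) ⇒ (9)–(10)** for cubes of size M = M′R₁M₁ ≦ R₁M₁(a₁/ε₁) («The condition M′ε₁ ≦ a₁ implies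
    M′B₃ε₁ ≦ a₅, hence we have proved the regularity conditions (9), (10)», p. 305), `B11Thm1Exact.SectFPrintedExact B₃ R₁M₁ fam`.
ONE constant `B₃` ((162)) and ONE `R₁M₁` ((1), (144)) serve all slots.  A node prover takes `(h : Hyp B₃ R₁M₁ δ₀ fam geo adm)`; the PROVED
rows of these pages (module docstring, § IN TREE) need no slot.  Nothing asserted. [cite: Balaban1985Variational, Sect. F pp.300–305:
p.300 ll.22–26 + (162) p.303 + p.304 ll.21–27 + Prop. 8 p.304 + (169) p.305 (bundle by name)] -/
def Hyp {I J : Type} (B₃ R₁M₁ δ₀ : ℝ) (fam : I → VarProblemX) (geo : J → B6.Geometry)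
    (adm : (j : J) → (geo j).Site → Prop) : Prop :=
  (∀ i : I, CubeSizeMultiplePrinted (fam i) R₁M₁) ∧
    B11B3.Claim162 δ₀ geo adm ∧
    (∃ a₅ : ℝ, 0 < a₅ ∧ ∀ i : I, B11Prop8Assembly.HalvingStep (fam i) B₃ a₅) ∧
    Prop8Printed B₃ fam ∧
    B11Thm1Exact.SectFPrintedExact B₃ R₁M₁ fam

namespace Hyp

variable {J : Type} {B₃ R₁M₁ δ₀ : ℝ} {fam : I → VarProblemX} {geo : J → B6.Geometry}
  {adm : (j : J) → (geo j).Site → Prop}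

/-- Accessor: the cube-size convention of p. 300, member by member. [cite: Balaban1985Variational, Sect. F p.300 ll.22–26] -/
theorem sizeMultiple (h : Hyp B₃ R₁M₁ δ₀ fam geo adm) (i : I) : CubeSizeMultiplePrinted (fam i) R₁M₁ := h.1 i

/-- Accessor: (162) «B₃ depends on d and L only» by name (`B11B3.Claim162`). [cite: Balaban1985Variational, (162) p.303] -/
theorem claim162 (h : Hyp B₃ R₁M₁ δ₀ fam geo adm) : B11B3.Claim162 δ₀ geo adm := h.2.1

/-- Accessor: the one-step conclusion of Sect. F (p. 304) with one absolute a₅, by name (`B11Prop8Assembly.HalvingStep`).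
[cite: Balaban1985Variational, Sect. F p.304 ll.21–27 (before Prop. 8)] -/
theorem halving (h : Hyp B₃ R₁M₁ δ₀ fam geo adm) :
    ∃ a₅ : ℝ, 0 < a₅ ∧ ∀ i : I, B11Prop8Assembly.HalvingStep (fam i) B₃ a₅ := h.2.2.1

/-- Accessor: Proposition 8 (p. 304) by name. [cite: Balaban1985Variational, Prop. 8 p.304] -/
theorem prop8 (h : Hyp B₃ R₁M₁ δ₀ fam geo adm) : Prop8Printed B₃ fam := h.2.2.2.1

/-- Accessor: the Sect. F conclusion (169) ⇒ (9)–(10) with the printed ceiling M ≦ R₁M₁(a₁/ε₁), by name.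
[cite: Balaban1985Variational, Sect. F (169) p.305] -/
theorem sectFExact (h : Hyp B₃ R₁M₁ δ₀ fam geo adm) : B11Thm1Exact.SectFPrintedExact B₃ R₁M₁ fam := h.2.2.2.2

/-- Derived: «In both cases M ≧ R₁M₁» for every class cube of every member (the `size_ge` shape of `B11SectFAssembly.Leaves` ∕
`B11SectFReg165Assembly.ChainLeaves`), for R₁M₁ ≥ 0. [cite: Balaban1985Variational, Sect. F p.300 (bookkeeping)] -/
theorem size_ge (h : Hyp B₃ R₁M₁ δ₀ fam geo adm) (hR : 0 ≤ R₁M₁) (i : I) (c : (fam i).Cube) :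
    R₁M₁ ≤ (fam i).sizeM c :=
  size_ge_of_multiple (h.sizeMultiple i) hR c

/-- Derived: the tree's `B11.SectFPrinted B₃ fam` (∃ RM) from the exact slot (`B11Thm1Exact.sectFPrinted_of_exact`, RM := R₁M₁ > 0).
[cite: Balaban1985Variational, Sect. F (169) pp.300–305 (bookkeeping)] -/
theorem sectF (h : Hyp B₃ R₁M₁ δ₀ fam geo adm) (hR : 0 < R₁M₁) : SectFPrinted B₃ fam :=
  B11Thm1Exact.sectFPrinted_of_exact hR fam h.sectFExact

/-- COHERENCE of the two Proposition-8 slots: the one-step conclusion (3) already gives Proposition 8 (4) — with the SAME a₅ — under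
the monotonicity of the spaces (2) in ε₀ (`B11.VarProblemX.Laws` (i)), by `B11Prop8Assembly.prop8Printed_of_halvingStep` («We
continue this way until we reach the bound B₃ε₁»). [cite: Balaban1985Variational, Prop. 8 p.304 (bookkeeping)] -/
theorem prop8_of_halving (h : Hyp B₃ R₁M₁ δ₀ fam geo adm) (hB₃ : 0 < B₃)
    (mono : ∀ (i : I) (e e' : ℝ) (U : (fam i).Cfg), e ≤ e' → (fam i).InU e U → (fam i).InU e' U) :
    Prop8Printed B₃ fam := by
  obtain ⟨a₅, ha₅, hstep⟩ := h.halving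
  exact B11Prop8Assembly.prop8Printed_of_halvingStep fam hB₃ ha₅ mono hstep

/-- Derived: **THEOREM 1 of [Balaban1985Variational] in the exact printed form** (M(ε₁) = R₁M₁(a₁/ε₁), `B11Thm1Exact.Thm1PrintedExact`)
from the bundle, GIVEN Proposition 7 (block 14's statement `B11.Prop7Printed B₃ C₁ fam`, p. 299) and the carrier dictionary
`B11.VarProblemX.Laws` — the architecture of pp. 281, 299, 304–305 by name (`B11Thm1Exact.thm1Exact_of_prop7_prop8_sectF`).
[cite: Balaban1985Variational, Thm 1 p.279 + Sect. F pp.304–305 (bookkeeping)] -/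
theorem thm1Exact (h : Hyp B₃ R₁M₁ δ₀ fam geo adm) {C₁ : ℝ} (hB₃ : 0 < B₃) (hC₁ : 0 < C₁) (hR : 0 < R₁M₁)
    (laws : ∀ i, (fam i).Laws) (h7 : Prop7Printed B₃ C₁ fam) :
    B11Thm1Exact.Thm1PrintedExact R₁M₁ (fun i => (fam i).toVarProblem) :=
  B11Thm1Exact.thm1Exact_of_prop7_prop8_sectF fam B₃ C₁ R₁M₁ hB₃ hC₁ hR laws h7 h.prop8 h.sectFExact

/-- Derived: **THEOREM 1 in the tree's form** `B11.Thm1Printed` (∃ M(·)), same inputs (`B11.thm1_of_prop7_prop8_sectF`).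
[cite: Balaban1985Variational, Thm 1 p.279 (bookkeeping)] -/
theorem thm1 (h : Hyp B₃ R₁M₁ δ₀ fam geo adm) {C₁ : ℝ} (hB₃ : 0 < B₃) (hC₁ : 0 < C₁) (hR : 0 < R₁M₁)
    (laws : ∀ i, (fam i).Laws) (h7 : Prop7Printed B₃ C₁ fam) :
    Thm1Printed (fun i => (fam i).toVarProblem) :=
  thm1_of_prop7_prop8_sectF fam B₃ C₁ hB₃ hC₁ laws h7 h.prop8 (h.sectF hR)

/-- Derived, the form row P11 «bg = [15] Thm 1 (8)–(10)» consumes: for a member `i`, data V with (7) at ε₁ ≦ a₁ and a configuration U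
critical in the space (8) = 𝔘_k(B₃ε₁) ∩ 𝔅_k(V), the regularity (9)–(10) (`B11.Regularity`, B₄ from the slot) holds on every class cube
with M ≦ R₁M₁(a₁/ε₁) — the Sect. F slot unfolded once. [cite: Balaban1985Variational, Sect. F (169) p.305 ⇒ (9)–(10) p.279 (bookkeeping)] -/
theorem regularity (h : Hyp B₃ R₁M₁ δ₀ fam geo adm) :
    ∃ a₁ B₄ : ℝ, 0 < a₁ ∧ 0 < B₄ ∧ ∀ (i : I) (ε₁ : ℝ) (V : (fam i).Bdry) (U : (fam i).Cfg), 0 < ε₁ → ε₁ ≤ a₁ →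
      (fam i).Reg7 ε₁ V → (fam i).InU (B₃ * ε₁) U → (fam i).InB V U → (fam i).IsCritical V U →
        ∀ c : (fam i).Cube, (fam i).sizeM c ≤ R₁M₁ * (a₁ / ε₁) →
          Regularity (fam i).toVarProblem B₃ B₄ ε₁ U c :=
  h.sectFExact

end Hyp

/-! ## §5 Non-vacuity: a one-point model on which `Hyp` holds, and one on which it fails -/

/-- A one-point model of the Theorem-1 carrier (all spaces = everything, all norms = 0, L = η = 1, one cube of scale 0 and size `s`) —
for the kernel witnesses below only; no content of the paper. [folklore] -/
def toyP (s : ℝ) : VarProblemX where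
  Cfg := Unit
  Bdry := Unit
  Cube := Unit
  scale := fun _ => 0
  sizeM := fun _ => s
  eta := 1
  L := 1
  InU := fun _ _ => True
  InB := fun _ _ => True
  Reg7 := fun _ _ => True
  OnMinimalOrbit := fun _ _ _ => True
  UniqueCriticalOrbit := fun _ _ _ => True
  Gauged := fun _ _ => True
  normA := fun _ _ => 0
  normGradA := fun _ _ => 0
  holderA := fun _ _ _ => 0
  normLapA := fun _ _ => 0
  IsCritical := fun _ _ => True
  SameOrbit := fun _ _ => True

/-- The empty family of multiscale geometries (the (162)-slot is then witnessed vacuously here; its honest witnesses are in tree: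
`B11B3.claim162_of_lemma21`, `B11SectFReg165AssemblyWitness.sum162_flat`). [folklore] -/
def noGeo : Empty → B6.Geometry := fun j => nomatch j

/-- The regularity (9)–(10) holds in the one-point model for positive B₃, B₄, s, ε₁ (all norms vanish) — non-vacuity witness for the typed
shape `B11.Regularity`, no content of the paper. [cite: Balaban1985Variational, (9)–(10) p.279 (non-vacuity witness; bookkeeping)] -/
theorem regularity_toyP {s B₃ B₄ ε₁ : ℝ} (hs : 0 < s) (hB₃ : 0 < B₃) (hB₄ : 0 < B₄) (hε₁ : 0 < ε₁) (U : Unit) (c : Unit) :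
    Regularity (toyP s).toVarProblem B₃ B₄ ε₁ U c := by
  refine ⟨trivial, ?_, ?_, ?_, ?_⟩
  · show (0 : ℝ) < B₃ * s * ε₁ * ((1 : ℝ) ^ (0 : ℕ) * 1)⁻¹ ^ 1
    norm_num; positivity
  · show (0 : ℝ) < B₃ * s * ε₁ * ((1 : ℝ) ^ (0 : ℕ) * 1)⁻¹ ^ 2
    norm_num; positivity
  · intro β _ _
    show (0 : ℝ) < B₄ * s * ε₁ * ((1 : ℝ) ^ (0 : ℕ) * 1)⁻¹ ^ (2 + β)
    rw [pow_zero, one_mul, inv_one, Real.one_rpow, mul_one]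
    positivity
  · show (0 : ℝ) < B₃ * s * ε₁ * ((1 : ℝ) ^ (0 : ℕ) * 1)⁻¹ ^ 3
    norm_num; positivity

/-- **`Hyp` IS SATISFIABLE with a nonempty index**: the constant family `fun _ : Unit => toyP R₁M₁` (every cube of size exactly R₁M₁,
M′ = 1) satisfies the bundle for any B₃ > 0, R₁M₁ > 0 (geometries: the empty family) — witness for the typed bundle, no content of the
paper. [cite: Balaban1985Variational, Sect. F pp.300–305 (non-vacuity witness of the bundle; bookkeeping)] -/
theorem hyp_toyP {B₃ R₁M₁ δ₀ : ℝ} (hB₃ : 0 < B₃) (hR : 0 < R₁M₁) :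
    Hyp B₃ R₁M₁ δ₀ (fun _ : Unit => toyP R₁M₁) noGeo (fun j => nomatch j) := by
  refine ⟨?_, ?_, ?_, ?_, ?_⟩
  · intro _ c
    exact ⟨1, le_rfl, by simp [toyP]⟩
  · exact ⟨0, fun j => nomatch j⟩
  · exact ⟨1, one_pos, fun _ => ⟨fun _ _ _ _ _ _ _ _ _ _ => trivial⟩⟩
  · exact ⟨1, one_pos, fun _ _ _ _ _ _ _ _ _ _ _ => trivial⟩
  · refine ⟨1, 1, one_pos, one_pos, ?_⟩
    intro i ε₁ V U hε₁ _ _ _ _ _ c _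
    exact regularity_toyP hR hB₃ one_pos hε₁ U c

/-- **`Hyp` IS NOT TRIVIALLY TRUE**: on the model whose cube has size R₁M₁/2 (not a positive-integer multiple of R₁M₁ > 0) the cube-size
conjunct, hence the bundle, fails — witness for the typed bundle, no content of the paper.
[cite: Balaban1985Variational, Sect. F p.300 ll.22–26 (non-triviality witness of the bundle; bookkeeping)] -/
theorem not_hyp_toyP_half {B₃ R₁M₁ δ₀ : ℝ} (hR : 0 < R₁M₁) :
    ¬ Hyp B₃ R₁M₁ δ₀ (fun _ : Unit => toyP (R₁M₁ / 2)) noGeo (fun j => nomatch j) := by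
  intro h
  obtain ⟨M', hM', hsize⟩ := h.sizeMultiple () ()
  have h1 : (1 : ℝ) ≤ (M' : ℝ) := by exact_mod_cast hM'
  have hs : (toyP (R₁M₁ / 2)).sizeM () = R₁M₁ / 2 := rfl
  rw [hs] at hsize
  nlinarith

end Literature.MathematicalPhysics.QuantumFieldTheory.Balaban1983to89.B11Carve15SectFHyp
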